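import Summits.CriticalPhenomena.PercolationContinuityZ3.Theses.PercLowPointHalfSpace
import Summits.CriticalPhenomena.PercolationContinuityZ3.Theses.PercNonProliferation
import Summits.CriticalPhenomena.PercolationContinuityZ3.Theorems.PercLowPointHalfSpaceBoundaryTwoArmDecayStubTallDensityCount
import Summits.CriticalPhenomena.PercolationContinuityZ3.Theorems.PercLowPointHalfSpaceLowPointIdentity
import Literature.Probability.Percolation.HalfSpacePinnedPairs

/-!
# Stub `stub_tallDensity` of crux `BoundaryTwoArmDecay` (stmt-CriticalPhenomena-0911), part 2: the stub

Proves EXACTLY the registered stub `stub_tallDensity` (TALL DENSITY) of the crux skeleton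
`Cruxes/BoundaryTwoArmDecay/Lines/staircase_bootstrap_floor_decoupling.lean` (line `staircase-bootstrap-floor-decoupling`,
crux `PercLowPointHalfSpace.BoundaryTwoArmDecay`, stmt-CriticalPhenomena-0911); lands with
`--supports stmt-CriticalPhenomena-0911`.  Part 1 (`…StubTallDensityCount`) is the deterministic counting.

## Statement

With `P = P_{p_c(ℤ³)}`, `ℍ = halfSpace 3 = {x | 0 ≤ x 0}`, `U = C_ℍ(0)`, `|U ∩ ∂ℍ| = halfSpaceFootprint` and
`ν_n := ∫ 1{U meets level n} · |U ∩ ∂ℍ|⁻¹ dP` (the density per floor site of `n`-tall wall clusters):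

  `SubpolynomialBlocking → ∀ s > 0, ∃ C, ∀ n ≥ 1, ν_n ≤ C n^{s-2}`,

where `SubpolynomialBlocking` (route item stmt-CriticalPhenomena-4446 of the sibling route `PercNonProliferation`, taken
BY NAME as the hypothesis) says that `u_m := P(no open path inside B(2m) from B(m) to ∂⁻B(2m)) ≥ m^{-s}` eventually.

## Proof

Fix `n` and `m` with `2m + 1 ≤ n`; let `Λ_m` be the floor patch `{x 0 = 0, |x 1|, |x 2| ≤ m}` (`(2m+1)²` sites) and
`A` the open crossing inside `ℍ ∩ B(2m)` from `Λ_m` to `∂⁻B(2m)`.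
* Translation invariance along the floor (`LowPoint.lintegral_shift`, `LowPoint.footprint_shift_eq`):
  `(2m+1)² ν_n = ∫ Σ_{x ∈ Λ_m} 1{C_ℍ(x) meets level n} |C_ℍ(x) ∩ ∂ℍ|⁻¹ dP`.
* Counting (part 1, `sum_weight_patch_le`, for the a.s. lattice configuration): the integrand is at most
  `Σ_{k < (2m+1)²} 1{A □^(k+1)}` — distinct tall clusters footed in the patch are disjoint crossings.
* BK–Reimer (`measureReal_disjointOccurrencePow_le`): `P(A □^(k+1)) ≤ P(A)^{k+1}`, and `P(A) ≤ 1 - u_m`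
  (`A` is contained in the annulus crossing event, `openCrossing_patch_subset`), so
  `(2m+1)² ν_n ≤ Σ_k (1-u_m)^{k+1} ≤ 1/u_m`.
* With `m = ⌊(n-1)/2⌋` and the hypothesis at exponent `s`: `ν_n ≤ m^s/(2m+1)² ≤ 4 n^{s-2}` for large `n`; for small
  `n`, `ν_n ≤ 1`.
-/

noncomputable section

namespace Summit.CriticalPhenomena.PercolationContinuityZ3.Theorems.BoundaryTwoArmDecay

open MeasureTheory
open scoped ENNReal
open Literature.Probability.Percolation Literature.Probability.LatticeModels

namespace StubTallDensity

/-! ### The integrand: measurability, bound by one, behaviour under floor shifts -/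

/-- The tall event `{C_ℍ(x) meets level n}` is measurable. -/
theorem measurableSet_tall (n : ℕ) (x : Site 3) :
    MeasurableSet {ω' : BondConfig (Site 3) | ∃ y : Site 3, (n : ℤ) ≤ y 0 ∧ ω' ∈ openConnIn (halfSpace 3) x y} := by
  have : {ω' : BondConfig (Site 3) | ∃ y : Site 3, (n : ℤ) ≤ y 0 ∧ ω' ∈ openConnIn (halfSpace 3) x y} =
      ⋃ y : Site 3, ⋃ (_ : (n : ℤ) ≤ y 0), openConnIn (halfSpace 3) x y := by
    ext ω
    simp only [Set.mem_setOf_eq, Set.mem_iUnion, exists_prop]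
  rw [this]
  exact MeasurableSet.iUnion fun y => MeasurableSet.iUnion fun _ => measurableSet_openConnIn_of_countable _ _ _

/-- The integrand `1{U meets level n} · |U ∩ ∂ℍ|⁻¹` is measurable. -/
theorem measurable_integrand (n : ℕ) :
    Measurable fun ω : BondConfig (Site 3) =>
      {ω' : BondConfig (Site 3) | ∃ y : Site 3, (n : ℤ) ≤ y 0 ∧ ω' ∈ openConnIn (halfSpace 3) 0 y}.indicator
        (fun ω' => (((halfSpaceFootprint ω' : ℕ∞) : ℝ≥0∞))⁻¹) ω := by
  refine Measurable.indicator ?_ (measurableSet_tall n 0)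
  exact ((Measurable.of_discrete (f := fun k : ℕ∞ => (k : ℝ≥0∞))).comp measurable_halfSpaceFootprint).inv

/-- The integrand is at most `1` (the footprint is at least `1`). -/
theorem integrand_le_one (n : ℕ) (ω : BondConfig (Site 3)) :
    {ω' : BondConfig (Site 3) | ∃ y : Site 3, (n : ℤ) ≤ y 0 ∧ ω' ∈ openConnIn (halfSpace 3) 0 y}.indicator
        (fun ω' => (((halfSpaceFootprint ω' : ℕ∞) : ℝ≥0∞))⁻¹) ω ≤ 1 := by
  refine (Set.indicator_le_self _ _ ω).trans (ENNReal.inv_le_one.2 ?_)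
  have h := ENat.toENNReal_le.2 (one_le_halfSpaceFootprint ω)
  rwa [ENat.toENNReal_one] at h

/-- `ν_n ≤ 1`. -/
theorem density_le_one (n : ℕ) :
    (∫⁻ ω, {ω | ∃ y : Site 3, (n : ℤ) ≤ y 0 ∧ ω ∈ openConnIn (halfSpace 3) 0 y}.indicator
        (fun ω => (((halfSpaceFootprint ω : ℕ∞) : ENNReal))⁻¹) ω
        ∂(bondPercolation (zdGraph 3) (criticalProbI 3))) ≤ 1 := by
  calc (∫⁻ ω, {ω | ∃ y : Site 3, (n : ℤ) ≤ y 0 ∧ ω ∈ openConnIn (halfSpace 3) 0 y}.indicator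
        (fun ω => (((halfSpaceFootprint ω : ℕ∞) : ENNReal))⁻¹) ω ∂(bondPercolation (zdGraph 3) (criticalProbI 3)))
      ≤ ∫⁻ _, 1 ∂(bondPercolation (zdGraph 3) (criticalProbI 3)) := lintegral_mono (integrand_le_one n)
    _ = 1 := by rw [lintegral_const, measure_univ, mul_one]

/-- **Floor shift.** For a floor site `x` (`x 0 = 0`), the integrand at the configuration shifted by `-x` (which moves
`x` to the origin) is the weight of `x`: `1{C_ℍ(x) meets level n}(ω) · |C_ℍ(x) ∩ ∂ℍ|⁻¹`. -/
theorem integrand_shift (n : ℕ) {x : Site 3} (hx : x 0 = 0) (ω : BondConfig (Site 3)) :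
    {ω' : BondConfig (Site 3) | ∃ y : Site 3, (n : ℤ) ≤ y 0 ∧ ω' ∈ openConnIn (halfSpace 3) 0 y}.indicator
        (fun ω' => (((halfSpaceFootprint ω' : ℕ∞) : ℝ≥0∞))⁻¹)
        (BondConfig.relabel (sym2Equiv (Site.shift (-x))) ω) =
      {ω' : BondConfig (Site 3) | ∃ y : Site 3, (n : ℤ) ≤ y 0 ∧ ω' ∈ openConnIn (halfSpace 3) x y}.indicator
        (fun ω' => (((({u | ω' ∈ openConnIn (halfSpace 3) x u} ∩ {u | u 0 = 0}).encard : ℕ∞) : ℝ≥0∞))⁻¹) ω := by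
  have hpre : ((fun u : Site 3 => u + -x) ⁻¹' halfSpace 3) = halfSpace 3 := by
    rw [show halfSpace 3 = {z : Site 3 | 0 ≤ z 0} from rfl, LowPoint.preimage_add_level]
    ext z
    simp only [Set.mem_setOf_eq, Pi.neg_apply, hx, neg_zero, sub_zero]
  have htall : BondConfig.relabel (sym2Equiv (Site.shift (-x))) ω ∈
      {ω' : BondConfig (Site 3) | ∃ y : Site 3, (n : ℤ) ≤ y 0 ∧ ω' ∈ openConnIn (halfSpace 3) 0 y} ↔
        ω ∈ {ω' : BondConfig (Site 3) | ∃ y : Site 3, (n : ℤ) ≤ y 0 ∧ ω' ∈ openConnIn (halfSpace 3) x y} := by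
    simp only [Set.mem_setOf_eq]
    constructor
    · rintro ⟨y, hy, h⟩
      rw [LowPoint.shift_mem_openConnIn_iff_sub, hpre, zero_sub, neg_neg, sub_neg_eq_add] at h
      exact ⟨y + x, by rw [Pi.add_apply, hx, add_zero]; exact hy, h⟩
    · rintro ⟨y, hy, h⟩
      refine ⟨y - x, by rw [Pi.sub_apply, hx, sub_zero]; exact hy, ?_⟩
      rw [LowPoint.shift_mem_openConnIn_iff_sub, hpre, zero_sub, neg_neg, sub_neg_eq_add, sub_add_cancel]
      exact h
  have hfoot : halfSpaceFootprint (BondConfig.relabel (sym2Equiv (Site.shift (-x))) ω) =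
      ({u | ω ∈ openConnIn (halfSpace 3) x u} ∩ {u | u 0 = 0}).encard := by
    rw [LowPoint.footprint_shift_eq]
    simp only [neg_neg, Pi.neg_apply, hx, neg_zero]
    rfl
  by_cases h : ω ∈ {ω' : BondConfig (Site 3) | ∃ y : Site 3, (n : ℤ) ≤ y 0 ∧ ω' ∈ openConnIn (halfSpace 3) x y}
  · rw [Set.indicator_of_mem (htall.2 h), Set.indicator_of_mem h, hfoot]
  · rw [Set.indicator_of_notMem (fun h' => h (htall.1 h')), Set.indicator_of_notMem h]

/-! ### The main estimate: `(2m+1)² ν_n ≤ 1/u_m` -/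

/-- **Main estimate.** For `2m + 1 ≤ n` and `u_m = P(no open path inside B(2m) from B(m) to ∂⁻B(2m)) > 0`:
`ν_n ≤ 1 / (u_m (2m+1)²)` (translation invariance, counting, BK–Reimer and a geometric series). -/
theorem density_le {n m : ℕ} (hmn : 2 * m + 1 ≤ n)
    (hu : 0 < (bondPercolation (zdGraph 3) (criticalProbI 3)).real
      {ω | ¬ ∃ x ∈ box 3 m, ∃ y ∈ innerBoundary (zdGraph 3) (box 3 (2 * m)), ω ∈ openConnIn ↑(box 3 (2 * m)) x y}) :
    (∫⁻ ω, {ω | ∃ y : Site 3, (n : ℤ) ≤ y 0 ∧ ω ∈ openConnIn (halfSpace 3) 0 y}.indicator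
        (fun ω => (((halfSpaceFootprint ω : ℕ∞) : ENNReal))⁻¹) ω
        ∂(bondPercolation (zdGraph 3) (criticalProbI 3))) ≤
      ENNReal.ofReal (1 / ((bondPercolation (zdGraph 3) (criticalProbI 3)).real
        {ω | ¬ ∃ x ∈ box 3 m, ∃ y ∈ innerBoundary (zdGraph 3) (box 3 (2 * m)), ω ∈ openConnIn ↑(box 3 (2 * m)) x y} *
          ((2 * m + 1 : ℕ) : ℝ) ^ 2)) := by
  classical
  -- abbreviations
  set F : BondConfig (Site 3) → ℝ≥0∞ := fun ω =>
    {ω' : BondConfig (Site 3) | ∃ y : Site 3, (n : ℤ) ≤ y 0 ∧ ω' ∈ openConnIn (halfSpace 3) 0 y}.indicator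
      (fun ω' => (((halfSpaceFootprint ω' : ℕ∞) : ℝ≥0∞))⁻¹) ω with hF
  set P : Finset (Site 3) :=
    Fintype.piFinset fun i : Fin 3 => if i = 0 then ({0} : Finset ℤ) else Finset.Icc (-(m : ℤ)) m with hP
  set R : Finset (Site 3) := (box 3 (2 * m)).filter fun z : Site 3 => 0 ≤ z 0 with hR
  set A : Set (BondConfig (Site 3)) :=
    openCrossing (↑R : Set (Site 3)) ↑P ↑(innerBoundary (zdGraph 3) (box 3 (2 * m))) with hA
  set Cr : Set (BondConfig (Site 3)) := {ω | ∃ x ∈ box 3 m, ∃ y ∈ innerBoundary (zdGraph 3) (box 3 (2 * m)),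
    ω ∈ openConnIn ↑(box 3 (2 * m)) x y} with hCr
  set u : ℝ := (bondPercolation (zdGraph 3) (criticalProbI 3)).real
    {ω | ¬ ∃ x ∈ box 3 m, ∃ y ∈ innerBoundary (zdGraph 3) (box 3 (2 * m)), ω ∈ openConnIn ↑(box 3 (2 * m)) x y}
    with hudef
  set θ : ℝ := (bondPercolation (zdGraph 3) (criticalProbI 3)).real A with hθdef
  show (∫⁻ ω, F ω ∂(bondPercolation (zdGraph 3) (criticalProbI 3))) ≤
    ENNReal.ofReal (1 / (u * ((2 * m + 1 : ℕ) : ℝ) ^ 2))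
  have hcard : P.card = (2 * m + 1) ^ 2 := card_patch m
  have hFm : Measurable F := measurable_integrand n
  -- Step 1: translation invariance along the floor
  have h1 : (P.card : ℝ≥0∞) * ∫⁻ ω, F ω ∂(bondPercolation (zdGraph 3) (criticalProbI 3)) =
      ∫⁻ ω, ∑ x ∈ P, F (BondConfig.relabel (sym2Equiv (Site.shift (-x))) ω)
        ∂(bondPercolation (zdGraph 3) (criticalProbI 3)) := by
    rw [lintegral_finsetSum P (f := fun x ω => F (BondConfig.relabel (sym2Equiv (Site.shift (-x))) ω))
      fun x _ => hFm.comp (BondConfig.relabel (sym2Equiv (Site.shift (-x)))).measurable]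
    rw [Finset.sum_congr rfl fun x _ => LowPoint.lintegral_shift (-x) (criticalProbI 3) F, Finset.sum_const,
      nsmul_eq_mul]
  -- Step 2: counting, almost surely (lattice configurations)
  have hae : ∀ᵐ ω ∂(bondPercolation (zdGraph 3) (criticalProbI 3)), ω ⊆ (zdGraph 3).edgeSet :=
    ProbabilityTheory.setBernoulli_ae_subset
  have h2 : ∀ᵐ ω ∂(bondPercolation (zdGraph 3) (criticalProbI 3)),
      ∑ x ∈ P, F (BondConfig.relabel (sym2Equiv (Site.shift (-x))) ω) ≤
        ∑ k ∈ Finset.range P.card, (disjointOccurrencePow A (k + 1)).indicator 1 ω := by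
    filter_upwards [hae] with ω hω
    rw [Finset.sum_congr rfl fun x hx => integrand_shift n (mem_patch_iff.1 hx).1 ω]
    exact sum_weight_patch_le hω hmn
  -- Step 3: BK–Reimer for the local increasing event `A`
  have hAloc : IsLocalEvent A := isLocalEvent_openCrossing R _ _
  have hmeas : ∀ k, MeasurableSet (disjointOccurrencePow A (k + 1)) := fun k => by
    obtain ⟨T, hT⟩ := hAloc.disjointOccurrencePow (k + 1)
    exact hT.measurableSet_of_finset
  have h3 : (∫⁻ ω, ∑ k ∈ Finset.range P.card, (disjointOccurrencePow A (k + 1)).indicator 1 ω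
      ∂(bondPercolation (zdGraph 3) (criticalProbI 3))) ≤
        ENNReal.ofReal (∑ k ∈ Finset.range P.card, θ ^ (k + 1)) := by
    rw [lintegral_finsetSum _ fun k _ => measurable_one.indicator (hmeas k),
      ENNReal.ofReal_sum_of_nonneg fun k _ => pow_nonneg measureReal_nonneg _]
    refine Finset.sum_le_sum fun k _ => ?_
    rw [lintegral_indicator_one (hmeas k), ← ofReal_measureReal (measure_ne_top _ _)]
    exact ENNReal.ofReal_le_ofReal
      (measureReal_disjointOccurrencePow_le (zdGraph 3) (criticalProbI 3) hAloc (k + 1))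
  -- Step 4: `θ ≤ 1 - u` and the geometric series
  have hCr_meas : MeasurableSet Cr := by
    have : Cr = openCrossing (↑(box 3 (2 * m)) : Set (Site 3)) ↑(box 3 m)
        ↑(innerBoundary (zdGraph 3) (box 3 (2 * m))) := by
      ext ω
      simp only [hCr, Set.mem_setOf_eq, mem_openCrossing_iff, Finset.mem_coe]
    rw [this]
    exact measurableSet_openCrossing _ _ _
  have hθu : θ ≤ 1 - u := by
    have hcompl : (bondPercolation (zdGraph 3) (criticalProbI 3)).real Crᶜ = u := by
      rw [hudef, hCr, Set.compl_setOf]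
    calc θ ≤ (bondPercolation (zdGraph 3) (criticalProbI 3)).real Cr :=
          measureReal_mono (openCrossing_patch_subset m) (measure_ne_top _ _)
      _ = 1 - u := by rw [← hcompl, measureReal_compl hCr_meas, probReal_univ, sub_sub_cancel]
  have hθ0 : 0 ≤ θ := measureReal_nonneg
  have hu1 : u ≤ 1 := measureReal_le_one
  have h4 : ∑ k ∈ Finset.range P.card, θ ^ (k + 1) ≤ 1 / u := by
    calc ∑ k ∈ Finset.range P.card, θ ^ (k + 1)
        ≤ ∑ k ∈ Finset.range P.card, (1 - u) ^ k := Finset.sum_le_sum fun k _ =>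
          (pow_le_pow_left₀ hθ0 hθu (k + 1)).trans
            (pow_le_pow_of_le_one (by linarith) (by linarith) (Nat.le_succ k))
      _ ≤ (1 - u) ^ 0 / (1 - (1 - u)) := by
          rw [Finset.range_eq_Ico]
          exact geom_sum_Ico_le_of_lt_one (by linarith) (by linarith)
      _ = 1 / u := by rw [pow_zero, sub_sub_cancel]
  -- Step 5: assemble in `ℝ≥0∞`
  have hmain : (P.card : ℝ≥0∞) * ∫⁻ ω, F ω ∂(bondPercolation (zdGraph 3) (criticalProbI 3)) ≤
      ENNReal.ofReal (1 / u) :=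
    calc (P.card : ℝ≥0∞) * ∫⁻ ω, F ω ∂(bondPercolation (zdGraph 3) (criticalProbI 3))
        = ∫⁻ ω, ∑ x ∈ P, F (BondConfig.relabel (sym2Equiv (Site.shift (-x))) ω)
            ∂(bondPercolation (zdGraph 3) (criticalProbI 3)) := h1
      _ ≤ ∫⁻ ω, ∑ k ∈ Finset.range P.card, (disjointOccurrencePow A (k + 1)).indicator 1 ω
            ∂(bondPercolation (zdGraph 3) (criticalProbI 3)) := lintegral_mono_ae h2
      _ ≤ ENNReal.ofReal (∑ k ∈ Finset.range P.card, θ ^ (k + 1)) := h3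
      _ ≤ ENNReal.ofReal (1 / u) := ENNReal.ofReal_le_ofReal h4
  have hcpos : (0 : ℝ) < ((2 * m + 1 : ℕ) : ℝ) ^ 2 := by positivity
  have hcne : (P.card : ℝ≥0∞) ≠ 0 := by
    rw [hcard]
    exact_mod_cast pow_ne_zero 2 (Nat.succ_ne_zero (2 * m))
  calc (∫⁻ ω, F ω ∂(bondPercolation (zdGraph 3) (criticalProbI 3)))
      ≤ ENNReal.ofReal (1 / u) / (P.card : ℝ≥0∞) := by
        rw [ENNReal.le_div_iff_mul_le (Or.inl hcne) (Or.inl (ENNReal.natCast_ne_top _)), mul_comm]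
        exact hmain
    _ = ENNReal.ofReal (1 / (u * ((2 * m + 1 : ℕ) : ℝ) ^ 2)) := by
        rw [hcard, ← div_div, ENNReal.ofReal_div_of_pos hcpos, ← Nat.cast_pow, ENNReal.ofReal_natCast]

end StubTallDensity

open StubTallDensity in
/-- **STUB `stub_tallDensity`** (TALL DENSITY, line `staircase-bootstrap-floor-decoupling` of crux `BoundaryTwoArmDecay`,
stmt-CriticalPhenomena-0911), registered signature verbatim: GIVEN `SubpolynomialBlocking` (stmt-CriticalPhenomena-4446,
by name), for every `s > 0` there is `C` with `ν_n = ∫ 1{C_ℍ(0) meets level n} |C_ℍ(0) ∩ ∂ℍ|⁻¹ dP_{p_c} ≤ C n^{s-2}`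
for all `n ≥ 1`. -/
theorem stub_tallDensity :
    Summit.CriticalPhenomena.PercolationContinuityZ3.Theses.PercNonProliferation.SubpolynomialBlocking →
      ∀ s : ℝ, 0 < s → ∃ C : ℝ, ∀ n : ℕ, 1 ≤ n →
        (∫⁻ ω, {ω | ∃ y : Site 3, (n : ℤ) ≤ y 0 ∧ ω ∈ openConnIn (halfSpace 3) 0 y}.indicator
            (fun ω => (((halfSpaceFootprint ω : ℕ∞) : ENNReal))⁻¹) ω
            ∂(bondPercolation (zdGraph 3) (criticalProbI 3))) ≤
          ENNReal.ofReal (C * (n : ℝ) ^ (s - 2)) := by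
  intro hB s hs
  obtain ⟨N₀, hN₀⟩ := Filter.eventually_atTop.1 (hB s hs)
  set N₁ : ℕ := 2 * N₀ + 3 with hN₁
  refine ⟨4 + (N₁ : ℝ) ^ 2, fun n hn => ?_⟩
  have hn1 : (1 : ℝ) ≤ n := by exact_mod_cast hn
  have hnpos : (0 : ℝ) < n := by linarith
  -- `n^{s-2} = n^s / n^2 ≥ 1 / n^2`
  have hsplit : (n : ℝ) ^ (s - 2) = (n : ℝ) ^ s / (n : ℝ) ^ 2 := by
    rw [Real.rpow_sub hnpos, Real.rpow_two]
  have hns : (1 : ℝ) ≤ (n : ℝ) ^ s := Real.one_le_rpow hn1 hs.le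
  by_cases hsmall : n < N₁
  · -- small `n`: `ν_n ≤ 1 ≤ N₁² / n² ≤ C n^{s-2}`
    refine (density_le_one n).trans ?_
    rw [← ENNReal.ofReal_one]
    refine ENNReal.ofReal_le_ofReal ?_
    rw [hsplit]
    have hnN : (n : ℝ) ≤ N₁ := by exact_mod_cast hsmall.le
    have hn2 : (n : ℝ) ^ 2 ≤ (N₁ : ℝ) ^ 2 := pow_le_pow_left₀ hnpos.le hnN 2
    have hn2pos : (0 : ℝ) < (n : ℝ) ^ 2 := by positivity
    have hq : (1 : ℝ) / (n : ℝ) ^ 2 ≤ (n : ℝ) ^ s / (n : ℝ) ^ 2 := div_le_div_of_nonneg_right hns hn2pos.le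
    have h1q : (1 : ℝ) ≤ (N₁ : ℝ) ^ 2 * (1 / (n : ℝ) ^ 2) := by
      rw [mul_one_div, le_div_iff₀ hn2pos, one_mul]
      exact hn2
    calc (1 : ℝ) ≤ (N₁ : ℝ) ^ 2 * (1 / (n : ℝ) ^ 2) := h1q
      _ ≤ (4 + (N₁ : ℝ) ^ 2) * ((n : ℝ) ^ s / (n : ℝ) ^ 2) :=
          mul_le_mul (by linarith) hq (by positivity) (by positivity)
  · -- large `n`: `m = ⌊(n-1)/2⌋ ≥ N₀`, `2m+1 ≤ n ≤ 2m+2`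
    push Not at hsmall
    set m : ℕ := (n - 1) / 2 with hm
    have hmN : N₀ ≤ m := by omega
    have hm1 : 1 ≤ m := by omega
    have hmn : 2 * m + 1 ≤ n := by omega
    have hnm : n ≤ 2 * m + 2 := by omega
    have hu := hN₀ m hmN
    have hmpos : (0 : ℝ) < m := by exact_mod_cast hm1
    have hms : (0 : ℝ) < (m : ℝ) ^ (-s) := Real.rpow_pos_of_pos hmpos _
    have hupos : 0 < (bondPercolation (zdGraph 3) (criticalProbI 3)).real
        {ω | ¬ ∃ x ∈ box 3 m, ∃ y ∈ innerBoundary (zdGraph 3) (box 3 (2 * m)),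
          ω ∈ openConnIn ↑(box 3 (2 * m)) x y} := hms.trans_le hu
    refine (density_le hmn hupos).trans (ENNReal.ofReal_le_ofReal ?_)
    -- real arithmetic: `1 / (u (2m+1)²) ≤ m^s / (2m+1)² ≤ 4 n^s / n² ≤ (4 + N₁²) n^{s-2}`
    have hc : ((n : ℝ) / 2) ^ 2 ≤ ((2 * m + 1 : ℕ) : ℝ) ^ 2 := by
      have : (n : ℝ) / 2 ≤ ((2 * m + 1 : ℕ) : ℝ) := by
        rw [div_le_iff₀ (by norm_num : (0 : ℝ) < 2)]
        have : (n : ℝ) ≤ 2 * m + 2 := by exact_mod_cast hnm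
        push_cast
        linarith
      exact pow_le_pow_left₀ (by positivity) this 2
    have hcpos : (0 : ℝ) < ((2 * m + 1 : ℕ) : ℝ) ^ 2 := by positivity
    have hms' : (m : ℝ) ^ s ≤ (n : ℝ) ^ s :=
      Real.rpow_le_rpow hmpos.le (by exact_mod_cast (by omega : m ≤ n)) hs.le
    calc 1 / ((bondPercolation (zdGraph 3) (criticalProbI 3)).real
            {ω | ¬ ∃ x ∈ box 3 m, ∃ y ∈ innerBoundary (zdGraph 3) (box 3 (2 * m)),
              ω ∈ openConnIn ↑(box 3 (2 * m)) x y} * ((2 * m + 1 : ℕ) : ℝ) ^ 2)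
        ≤ 1 / ((m : ℝ) ^ (-s) * ((2 * m + 1 : ℕ) : ℝ) ^ 2) :=
          one_div_le_one_div_of_le (mul_pos hms hcpos) (mul_le_mul_of_nonneg_right hu hcpos.le)
      _ = (m : ℝ) ^ s / ((2 * m + 1 : ℕ) : ℝ) ^ 2 := by
          rw [Real.rpow_neg hmpos.le, one_div, mul_inv, inv_inv, div_eq_mul_inv]
      _ ≤ (n : ℝ) ^ s / ((n : ℝ) / 2) ^ 2 := by
          gcongr
      _ = 4 * ((n : ℝ) ^ s / (n : ℝ) ^ 2) := by
          field_simp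
          ring
      _ ≤ (4 + (N₁ : ℝ) ^ 2) * (n : ℝ) ^ (s - 2) := by
          rw [hsplit]
          have : (0 : ℝ) ≤ (n : ℝ) ^ s / (n : ℝ) ^ 2 := by positivity
          nlinarith [sq_nonneg (N₁ : ℝ)]

end Summit.CriticalPhenomena.PercolationContinuityZ3.Theorems.BoundaryTwoArmDecay

end
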